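import Literature.Probability.RandomPlanarGeometry.SAWTiltedFiniteMemory
import HarnessLib

/-!
# The memory-16 certificate tilted along the direction `(2,1)` with base `11/10` (`native_decide`)

Topic `Literature/Probability/RandomPlanarGeometry` (an instance of `FiniteMemory.checkT`, `SAWTiltedFiniteMemory.lean`).
Letter weights `W(+e₀) = 11⁴`, `W(+e₁) = 11³·10`, `W(−e₀) = 10⁴`, `W(−e₁) = 11·10³`, i.e. `W(d) = (11·10)²·(11/10)^{2dx(d)+dy(d)}`:
the tilt `r^{2x+y}` with `r = 11/10` (direction `(2,1)/√5`, strength `√5·log(11/10) = 0.2131` per unit length).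
Certified: `Σ_{w ∈ sawWords n} Π W(w_i) · 1000ⁿ ≤ 34181244ⁿ · 2⁴¹`, i.e. the tilted growth rate is at most
`34181244/(1000·110²) = 2.824896…` (467 249 states, 60 power iterations; telemetry `ratioT` = 34181.243872).
Used by the sixteen-direction sub-ballisticity bound. The only non-standard axiom is `Lean.ofReduceBool`.
[cite: PonitzTittmann2000, §3; DuminilCopinHammond2013, §2.4]
-/

namespace Literature.Probability.RandomPlanarGeometry.SAW.FiniteMemory

/-- The `(2,1)`-tilted memory-16 certificate at base `11/10`: `checkT 16 11⁴ (11³·10) 10⁴ (11·10³) 34181244 1000 60`.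
[cite: PonitzTittmann2000, §3] -/
theorem checkT_16_d21_11_10 : checkT 16 14641 13310 10000 11000 34181244 1000 60 = true := by
  native_decide

end Literature.Probability.RandomPlanarGeometry.SAW.FiniteMemory
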